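import Summits.QuantumFields.YangMills.Theorems.AllWindowsColdBoxBoxHighLineEdgeChartMoments
import Summits.QuantumFields.YangMills.Theorems.AllWindowsColdBoxBoxHighLineGaussianPolyIntegrable

/-!
# T-S5.10, part 1 — hypercontractivity IN THE EDGE CHART, polynomial certificates of the STEP-2 observables, and the variance of `|ℓ_p|²`

Planner ym-idea-2 g18's `TaskS5Step2Wick.lean` T-S5.10 `CubicDecorrelation` needs, for `c̃ = |ℓ_p|² − E₀|ℓ_p|²` (degree 2) and the triple-product part `βΣP`
(degree 3) resp. `(a_e^c)⁵` (degree 5), the Bonami–Nelson bound `E₀[F²G²] ≤ 3^{p+q} E₀[F²]E₀[G²]` — w5 g22's ✓`Hypercontractivity.…_of_polyDeg` (flat letters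
`v : ι → ℝ`, weight `e^{−β vPv}`) transferred to `a : LandauFree H → ℝ³` along ✓`LaplaceSandwich.flatten` with `P = hodgeQ H ⊗ₖ 1`.  This file supplies:

* §1 (w5 g22's ✓`Hypercontractivity.integrable_eval_mul_exp_quadForm'`: every polynomial times `e^{−βvPv}` is integrable);
* §2 certificates `∃ Q : MvPolynomial (LandauFree H × Fin 3) ℝ, Q.totalDegree ≤ d ∧ ∀ a, F a = eval (flatten a) Q` for the chart observables: closure under
  `+ − · ^ Σ`, constants, coordinates, ★`polyCert_linCurvSq` (degree 2), ★`polyCert_tripleFormSum` (degree 3); `integrable_polyCert_mul_gaussWeight`;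
* §3 ★`gaussAvg_sq_mul_sq_le_of_polyCert` — `E₀[F²G²] ≤ 3^{p+q}·E₀[F²]·E₀[G²]` in `gaussAvg` letters;
* §4 ★`gaussAvg_centred_linCurvSq_sq_le` — `Var₀(|ℓ_p|²) ≤ 384·C²·(1+log H)²/β²` (`C` = ✓S3b's constant; exact value `(3/2)β⁻²K_pp²`, `K_pp ≤ 16C(1+log H)`).

Tree (✓EdgeChartMoments chain, w5 g22's ✓GaussianHypercontractivityPoly) + Mathlib; no definitions.  HONEST LABEL: bookkeeping for T-S5.10 of STEP 2 of the XL stub S5 of a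
critic-PASSed DRAFT line; 7a, 10, T-S5.13/S5, U5, ⟨24004⟩ ⟨24335⟩ ⟨24336⟩ remain OPEN; route AllWindowsColdBox is DRAFT; no rung is proved; the Yang–Mills mass gap is NOT
proved by this file.  Seat ym-line-sfw-p2 g77 (LEAD, cell ym-idea-1; Wick layer T-S5.10/11/12a).
-/

set_option autoImplicit false

noncomputable section

open MeasureTheory Matrix Finset
open scoped Kronecker Nat Matrix
open Literature.Probability.LatticeModels (Site)
open Literature.MathematicalPhysics.QuantumLattice (ZdPlaquette plaquettesTouching)

namespace Summit.QuantumFields.YangMills.Theorems.AllWindowsColdBoxBoxHighLine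

namespace EdgeChartGaussian

open LaplaceSandwich (flatten flatten_apply volume_preserving_flatten)
open GaussianChartWick

/-! ## §1 Polynomials are integrable against `e^{−βvPv}` — this is w5 g22's ✓`Hypercontractivity.integrable_eval_mul_exp_quadForm'`
(`…GaussianPolyIntegrable`), used below by name. -/

/-! ## §2 Polynomial certificates in the edge chart -/

variable {H : ℕ}

/-- Constants. -/
theorem polyCert_const (c : ℝ) (d : ℕ) :
    ∃ Q : MvPolynomial (LandauFree H × Fin 3) ℝ, Q.totalDegree ≤ d ∧ ∀ a : LandauFree H → E3, c = MvPolynomial.eval (flatten (LandauFree H) a) Q :=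
  ⟨MvPolynomial.C c, by rw [MvPolynomial.totalDegree_C]; exact Nat.zero_le _, fun a => by rw [MvPolynomial.eval_C]⟩

/-- Coordinates `(a_e)_c`. -/
theorem polyCert_coord (e : LandauFree H) (c : Fin 3) {d : ℕ} (hd : 1 ≤ d) :
    ∃ Q : MvPolynomial (LandauFree H × Fin 3) ℝ, Q.totalDegree ≤ d ∧ ∀ a : LandauFree H → E3, a e c = MvPolynomial.eval (flatten (LandauFree H) a) Q :=
  ⟨MvPolynomial.X (e, c), by rw [MvPolynomial.totalDegree_X]; exact hd, fun a => by rw [MvPolynomial.eval_X]; rfl⟩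

/-- Monotonicity in the degree. -/
theorem polyCert_mono {F : (LandauFree H → E3) → ℝ} {d d' : ℕ} (hdd : d ≤ d')
    (hF : ∃ Q : MvPolynomial (LandauFree H × Fin 3) ℝ, Q.totalDegree ≤ d ∧ ∀ a, F a = MvPolynomial.eval (flatten (LandauFree H) a) Q) :
    ∃ Q : MvPolynomial (LandauFree H × Fin 3) ℝ, Q.totalDegree ≤ d' ∧ ∀ a, F a = MvPolynomial.eval (flatten (LandauFree H) a) Q := by
  obtain ⟨Q, hQ, h⟩ := hF; exact ⟨Q, hQ.trans hdd, h⟩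

/-- Sums. -/
theorem polyCert_add {F G : (LandauFree H → E3) → ℝ} {d : ℕ}
    (hF : ∃ Q : MvPolynomial (LandauFree H × Fin 3) ℝ, Q.totalDegree ≤ d ∧ ∀ a, F a = MvPolynomial.eval (flatten (LandauFree H) a) Q)
    (hG : ∃ Q : MvPolynomial (LandauFree H × Fin 3) ℝ, Q.totalDegree ≤ d ∧ ∀ a, G a = MvPolynomial.eval (flatten (LandauFree H) a) Q) :
    ∃ Q : MvPolynomial (LandauFree H × Fin 3) ℝ, Q.totalDegree ≤ d ∧ ∀ a, F a + G a = MvPolynomial.eval (flatten (LandauFree H) a) Q := by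
  obtain ⟨A, hA, hFA⟩ := hF
  obtain ⟨B, hB, hGB⟩ := hG
  exact ⟨A + B, (MvPolynomial.totalDegree_add A B).trans (max_le hA hB), fun a => by rw [map_add, hFA, hGB]⟩

/-- Differences. -/
theorem polyCert_sub {F G : (LandauFree H → E3) → ℝ} {d : ℕ}
    (hF : ∃ Q : MvPolynomial (LandauFree H × Fin 3) ℝ, Q.totalDegree ≤ d ∧ ∀ a, F a = MvPolynomial.eval (flatten (LandauFree H) a) Q)
    (hG : ∃ Q : MvPolynomial (LandauFree H × Fin 3) ℝ, Q.totalDegree ≤ d ∧ ∀ a, G a = MvPolynomial.eval (flatten (LandauFree H) a) Q) :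
    ∃ Q : MvPolynomial (LandauFree H × Fin 3) ℝ, Q.totalDegree ≤ d ∧ ∀ a, F a - G a = MvPolynomial.eval (flatten (LandauFree H) a) Q := by
  obtain ⟨A, hA, hFA⟩ := hF
  obtain ⟨B, hB, hGB⟩ := hG
  exact ⟨A - B, (MvPolynomial.totalDegree_sub A B).trans (max_le hA hB), fun a => by rw [map_sub, hFA, hGB]⟩

/-- Scalar multiples. -/
theorem polyCert_const_mul (c : ℝ) {F : (LandauFree H → E3) → ℝ} {d : ℕ}
    (hF : ∃ Q : MvPolynomial (LandauFree H × Fin 3) ℝ, Q.totalDegree ≤ d ∧ ∀ a, F a = MvPolynomial.eval (flatten (LandauFree H) a) Q) :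
    ∃ Q : MvPolynomial (LandauFree H × Fin 3) ℝ, Q.totalDegree ≤ d ∧ ∀ a, c * F a = MvPolynomial.eval (flatten (LandauFree H) a) Q := by
  obtain ⟨A, hA, hFA⟩ := hF
  refine ⟨MvPolynomial.C c * A, (MvPolynomial.totalDegree_mul _ _).trans ?_, fun a => by rw [map_mul, MvPolynomial.eval_C, hFA]⟩
  rw [MvPolynomial.totalDegree_C, zero_add]; exact hA

/-- Products (degrees add). -/
theorem polyCert_mul {F G : (LandauFree H → E3) → ℝ} {p q : ℕ}
    (hF : ∃ Q : MvPolynomial (LandauFree H × Fin 3) ℝ, Q.totalDegree ≤ p ∧ ∀ a, F a = MvPolynomial.eval (flatten (LandauFree H) a) Q)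
    (hG : ∃ Q : MvPolynomial (LandauFree H × Fin 3) ℝ, Q.totalDegree ≤ q ∧ ∀ a, G a = MvPolynomial.eval (flatten (LandauFree H) a) Q) :
    ∃ Q : MvPolynomial (LandauFree H × Fin 3) ℝ, Q.totalDegree ≤ p + q ∧ ∀ a, F a * G a = MvPolynomial.eval (flatten (LandauFree H) a) Q := by
  obtain ⟨A, hA, hFA⟩ := hF
  obtain ⟨B, hB, hGB⟩ := hG
  exact ⟨A * B, (MvPolynomial.totalDegree_mul A B).trans (add_le_add hA hB), fun a => by rw [map_mul, hFA, hGB]⟩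

/-- Powers. -/
theorem polyCert_pow {F : (LandauFree H → E3) → ℝ} {p : ℕ}
    (hF : ∃ Q : MvPolynomial (LandauFree H × Fin 3) ℝ, Q.totalDegree ≤ p ∧ ∀ a, F a = MvPolynomial.eval (flatten (LandauFree H) a) Q) (n : ℕ) :
    ∃ Q : MvPolynomial (LandauFree H × Fin 3) ℝ, Q.totalDegree ≤ n * p ∧ ∀ a, F a ^ n = MvPolynomial.eval (flatten (LandauFree H) a) Q := by
  obtain ⟨A, hA, hFA⟩ := hF
  exact ⟨A ^ n, (MvPolynomial.totalDegree_pow A n).trans (Nat.mul_le_mul_left n hA), fun a => by rw [map_pow, hFA]⟩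

/-- Finite sums. -/
theorem polyCert_sum {κ : Type*} (s : Finset κ) {F : κ → (LandauFree H → E3) → ℝ} {d : ℕ}
    (hF : ∀ k ∈ s, ∃ Q : MvPolynomial (LandauFree H × Fin 3) ℝ, Q.totalDegree ≤ d ∧ ∀ a, F k a = MvPolynomial.eval (flatten (LandauFree H) a) Q) :
    ∃ Q : MvPolynomial (LandauFree H × Fin 3) ℝ, Q.totalDegree ≤ d ∧ ∀ a, ∑ k ∈ s, F k a = MvPolynomial.eval (flatten (LandauFree H) a) Q := by
  classical
  choose! Q hQ hFQ using hF
  refine ⟨∑ k ∈ s, Q k, MvPolynomial.totalDegree_finsetSum_le fun k hk => hQ k hk, fun a => ?_⟩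
  rw [MvPolynomial.eval_sum]
  exact Finset.sum_congr rfl fun k hk => hFQ k hk a

/-- ★ The quadratic plaquette observable `|ℓ_p|²` has degree ≤ 2. -/
theorem polyCert_linCurvSq (H : ℕ) (p : Literature.MathematicalPhysics.QuantumFieldTheory.Plaq 4) :
    ∃ Q : MvPolynomial (LandauFree H × Fin 3) ℝ, Q.totalDegree ≤ 2 ∧ ∀ a : LandauFree H → E3, linCurvSq H p a = MvPolynomial.eval (flatten (LandauFree H) a) Q := by
  obtain ⟨Q, hQ, h⟩ := exists_mvPolynomial_colourSumSq (I := LandauFree H) (landauCoeff H p)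
  exact ⟨Q, hQ, fun a => (h a).symm⟩

/-- ★ The triple-product part of the cubic vertex, `β·Σ_{p∈S} tripleForm (T p) (plaqVar_p a)`, has degree ≤ 3 (any finite set of plaquettes, any bounded `T`). -/
theorem polyCert_tripleFormSum (H : ℕ) (β : ℝ) (S : Finset (ZdPlaquette 4)) (T : ZdPlaquette 4 → Fin 4 → Fin 4 → Fin 4 → ℝ) {B : ℝ}
    (hT : ∀ p i j k, |T p i j k| ≤ B) :
    ∃ Q : MvPolynomial (LandauFree H × Fin 3) ℝ, Q.totalDegree ≤ 3 ∧ ∀ a : LandauFree H → E3,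
      β * ∑ p ∈ S, tripleForm (T p) (plaqVar H p.1 p.2.1.1 p.2.1.2 a) = MvPolynomial.eval (flatten (LandauFree H) a) Q := by
  classical
  refine polyCert_const_mul β (polyCert_sum S fun p _ => ?_)
  obtain ⟨K, _, cA, leg, -, -, -, hexp⟩ := tripleForm_plaqVar_expansion H p.1 p.2.1.1 p.2.1.2 (T p) (hT p)
  obtain ⟨Q, hQ, h⟩ := exists_mvPolynomial_sum_prodCoord (I := LandauFree H) (Finset.univ : Finset K) cA 3 leg
  exact ⟨Q, hQ, fun a => by rw [hexp a, h a]⟩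

/-- A certified polynomial observable times `gaussWeight` is integrable. -/
theorem integrable_polyCert_mul_gaussWeight (H : ℕ) {β : ℝ} (hβ : 0 < β) {F : (LandauFree H → E3) → ℝ} {d : ℕ}
    (hF : ∃ Q : MvPolynomial (LandauFree H × Fin 3) ℝ, Q.totalDegree ≤ d ∧ ∀ a, F a = MvPolynomial.eval (flatten (LandauFree H) a) Q) :
    Integrable (fun a : LandauFree H → E3 => F a * gaussWeight β H a) := by
  obtain ⟨Q, -, hFQ⟩ := hF
  have h := Hypercontractivity.integrable_eval_mul_exp_quadForm' _ (posDef_kronecker_one (o := Fin 3) (hodgeQ H) (hodgeQ_posDef H)) hβ Q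
  rw [← (volume_preserving_flatten (LandauFree H)).integrable_comp_emb (flatten (LandauFree H)).measurableEmbedding] at h
  refine h.congr (Filter.Eventually.of_forall fun a => ?_)
  simp only [Function.comp_apply, ← colourForm_eq_flat, hFQ a]
  rfl

/-! ## §3 Hypercontractivity in `gaussAvg` letters -/

/-- ★★ **Bonami–Nelson in the edge chart**: for chart observables `F`, `G` certified polynomial of degrees `≤ p`, `≤ q` in the flat variables,
`E₀[F²G²] ≤ 3^{p+q} · E₀[F²] · E₀[G²]` (w5 g22's ✓`Hypercontractivity.integral_sq_mul_sq_mul_integral_exp_le_of_polyDeg`, transported along ✓`flatten`). -/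
theorem gaussAvg_sq_mul_sq_le_of_polyCert (H : ℕ) {β : ℝ} (hβ : 0 < β) {F G : (LandauFree H → E3) → ℝ} {p q : ℕ}
    (hF : ∃ Q : MvPolynomial (LandauFree H × Fin 3) ℝ, Q.totalDegree ≤ p ∧ ∀ a, F a = MvPolynomial.eval (flatten (LandauFree H) a) Q)
    (hG : ∃ Q : MvPolynomial (LandauFree H × Fin 3) ℝ, Q.totalDegree ≤ q ∧ ∀ a, G a = MvPolynomial.eval (flatten (LandauFree H) a) Q) :
    gaussAvg β H (fun a => F a ^ 2 * G a ^ 2) ≤ (3 : ℝ) ^ (p + q) * gaussAvg β H (fun a => F a ^ 2) * gaussAvg β H (fun a => G a ^ 2) := by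
  obtain ⟨A, hA, hFA⟩ := hF
  obtain ⟨B, hB, hGB⟩ := hG
  set L := hodgeQ H ⊗ₖ (1 : Matrix (Fin 3) (Fin 3) ℝ) with hL
  have hLpd : L.PosDef := posDef_kronecker_one (o := Fin 3) (hodgeQ H) (hodgeQ_posDef H)
  -- move the four integrals to the flat chart
  have hI : ∀ Φ : (LandauFree H × Fin 3 → ℝ) → ℝ,
      (∫ a : LandauFree H → E3, Φ (flatten (LandauFree H) a) * gaussWeight β H a) =
        ∫ v : LandauFree H × Fin 3 → ℝ, Φ v * Real.exp (-(β * (v ⬝ᵥ L *ᵥ v))) := by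
    intro Φ
    rw [← integral_eq_flat]
    refine integral_congr_ae (Filter.Eventually.of_forall fun a => ?_)
    simp only [gaussWeight_eq, colourForm_eq_flat, hL]
  have hZ : (∫ a : LandauFree H → E3, gaussWeight β H a) = ∫ v : LandauFree H × Fin 3 → ℝ, Real.exp (-(β * (v ⬝ᵥ L *ᵥ v))) := by
    have h := hI (fun _ => 1)
    simpa only [one_mul] using h
  have h1 : (∫ a : LandauFree H → E3, F a ^ 2 * G a ^ 2 * gaussWeight β H a) =
      ∫ v : LandauFree H × Fin 3 → ℝ, MvPolynomial.eval v A ^ 2 * MvPolynomial.eval v B ^ 2 * Real.exp (-(β * (v ⬝ᵥ L *ᵥ v))) := by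
    rw [← hI (fun v => MvPolynomial.eval v A ^ 2 * MvPolynomial.eval v B ^ 2)]
    exact integral_congr_ae (Filter.Eventually.of_forall fun a => by simp only [hFA, hGB])
  have h2 : (∫ a : LandauFree H → E3, F a ^ 2 * gaussWeight β H a) =
      ∫ v : LandauFree H × Fin 3 → ℝ, MvPolynomial.eval v A ^ 2 * Real.exp (-(β * (v ⬝ᵥ L *ᵥ v))) := by
    rw [← hI (fun v => MvPolynomial.eval v A ^ 2)]
    exact integral_congr_ae (Filter.Eventually.of_forall fun a => by simp only [hFA])
  have h3 : (∫ a : LandauFree H → E3, G a ^ 2 * gaussWeight β H a) =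
      ∫ v : LandauFree H × Fin 3 → ℝ, MvPolynomial.eval v B ^ 2 * Real.exp (-(β * (v ⬝ᵥ L *ᵥ v))) := by
    rw [← hI (fun v => MvPolynomial.eval v B ^ 2)]
    exact integral_congr_ae (Filter.Eventually.of_forall fun a => by simp only [hGB])
  have hmain := Hypercontractivity.integral_sq_mul_sq_mul_integral_exp_le L hLpd hβ A B hA hB
  have hZpos := integral_gaussWeight_pos H hβ
  unfold gaussAvg
  rw [h1, h2, h3, hZ] at *
  rw [hZ] at hZpos
  -- `I₁/Z ≤ 3^{p+q} (I₂/Z)(I₃/Z)` from `I₁·Z ≤ 3^{p+q} I₂ I₃`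
  rw [div_le_iff₀ hZpos]
  have hZne : (∫ v : LandauFree H × Fin 3 → ℝ, Real.exp (-(β * (v ⬝ᵥ L *ᵥ v)))) ≠ 0 := hZpos.ne'
  calc (∫ v : LandauFree H × Fin 3 → ℝ, MvPolynomial.eval v A ^ 2 * MvPolynomial.eval v B ^ 2 * Real.exp (-(β * (v ⬝ᵥ L *ᵥ v))))
      = ((∫ v : LandauFree H × Fin 3 → ℝ, MvPolynomial.eval v A ^ 2 * MvPolynomial.eval v B ^ 2 * Real.exp (-(β * (v ⬝ᵥ L *ᵥ v)))) *
          ∫ v : LandauFree H × Fin 3 → ℝ, Real.exp (-(β * (v ⬝ᵥ L *ᵥ v)))) / ∫ v : LandauFree H × Fin 3 → ℝ, Real.exp (-(β * (v ⬝ᵥ L *ᵥ v))) := by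
        rw [mul_div_cancel_right₀ _ hZne]
    _ ≤ ((3 : ℝ) ^ (p + q) * (∫ v : LandauFree H × Fin 3 → ℝ, MvPolynomial.eval v A ^ 2 * Real.exp (-(β * (v ⬝ᵥ L *ᵥ v)))) *
          ∫ v : LandauFree H × Fin 3 → ℝ, MvPolynomial.eval v B ^ 2 * Real.exp (-(β * (v ⬝ᵥ L *ᵥ v)))) /
          ∫ v : LandauFree H × Fin 3 → ℝ, Real.exp (-(β * (v ⬝ᵥ L *ᵥ v))) := div_le_div_of_nonneg_right hmain hZpos.le
    _ = _ := by field_simp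

/-! ## §4 The variance of `|ℓ_p|²` -/

/-- `|coeffAux e q|` is at most the number of plaquette edges equal to `e` (in particular the circulation vector has `ℓ¹`-norm `≤ 4`). -/
theorem abs_coeffAux_le_indicators (e : Literature.MathematicalPhysics.QuantumLattice.ZdEdge 4) (q : Literature.MathematicalPhysics.QuantumFieldTheory.Plaq 4) :
    |Literature.MathematicalPhysics.QuantumFieldTheory.LatticeMaxwell.coeffAux e q| ≤
      (if e = (q.1, q.2.1) then (1 : ℝ) else 0) + (if e = (q.1 + Pi.single q.2.1 1, q.2.2) then (1 : ℝ) else 0) +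
        (if e = (q.1 + Pi.single q.2.2 1, q.2.1) then (1 : ℝ) else 0) + (if e = (q.1, q.2.2) then (1 : ℝ) else 0) := by
  unfold Literature.MathematicalPhysics.QuantumFieldTheory.LatticeMaxwell.coeffAux
  have h4 : ∀ (a b c d : ℝ), 0 ≤ a → 0 ≤ b → 0 ≤ c → 0 ≤ d → |a + b - c - d| ≤ a + b + c + d := by
    intro a b c d ha hb hc hd
    rw [abs_le]; constructor <;> linarith
  refine h4 _ _ _ _ ?_ ?_ ?_ ?_ <;> split_ifs <;> norm_num

/-- `Σ_{e free} |landauCoeff H p e| ≤ 4`. -/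
theorem sum_abs_landauCoeff_le (H : ℕ) (p : Literature.MathematicalPhysics.QuantumFieldTheory.Plaq 4) : ∑ e : LandauFree H, |landauCoeff H p e| ≤ 4 := by
  classical
  have h := fun e : LandauFree H => abs_coeffAux_le_indicators (e.1.1 : Literature.MathematicalPhysics.QuantumLattice.ZdEdge 4) p
  -- at most one free edge sits on a given lattice edge
  have hind : ∀ ed : Literature.MathematicalPhysics.QuantumLattice.ZdEdge 4,
      (∑ e : LandauFree H, if (e.1.1 : Literature.MathematicalPhysics.QuantumLattice.ZdEdge 4) = ed then (1 : ℝ) else 0) ≤ 1 := by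
    intro ed
    rw [Finset.sum_boole]
    have hcard : (Finset.univ.filter fun e : LandauFree H => (e.1.1 : Literature.MathematicalPhysics.QuantumLattice.ZdEdge 4) = ed).card ≤ 1 := by
      refine Finset.card_le_one.2 fun e he e' he' => ?_
      rw [Finset.mem_filter] at he he'
      exact landauFree_ext (he.2.trans he'.2.symm)
    exact_mod_cast hcard
  calc ∑ e : LandauFree H, |landauCoeff H p e|
      ≤ ∑ e : LandauFree H, ((if (e.1.1 : Literature.MathematicalPhysics.QuantumLattice.ZdEdge 4) = (p.1, p.2.1) then (1 : ℝ) else 0) +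
          (if (e.1.1 : Literature.MathematicalPhysics.QuantumLattice.ZdEdge 4) = (p.1 + Pi.single p.2.1 1, p.2.2) then (1 : ℝ) else 0) +
          (if (e.1.1 : Literature.MathematicalPhysics.QuantumLattice.ZdEdge 4) = (p.1 + Pi.single p.2.2 1, p.2.1) then (1 : ℝ) else 0) +
          (if (e.1.1 : Literature.MathematicalPhysics.QuantumLattice.ZdEdge 4) = (p.1, p.2.2) then (1 : ℝ) else 0)) :=
        Finset.sum_le_sum fun e _ => h e
    _ ≤ 1 + 1 + 1 + 1 := by
        rw [Finset.sum_add_distrib, Finset.sum_add_distrib, Finset.sum_add_distrib]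
        exact add_le_add (add_le_add (add_le_add (hind _) (hind _)) (hind _)) (hind _)
    _ = 4 := by norm_num

/-- ★ The Hodge kernel on the diagonal: `K_pp = λ_p·hodgeQ⁻¹·λ_p ≤ 16·C·(1 + log H)` for `H ≥ 1` (`C` = ✓S3b's constant, made `≥ 0`). -/
theorem landauCoeff_kernel_diag_le : ∃ C : ℝ, 0 ≤ C ∧ ∀ H : ℕ, 1 ≤ H → ∀ p : Literature.MathematicalPhysics.QuantumFieldTheory.Plaq 4,
    |landauCoeff H p ⬝ᵥ ((hodgeQ H)⁻¹ *ᵥ landauCoeff H p)| ≤ 16 * C * (1 + Real.log H) := by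
  obtain ⟨C, hC⟩ := stub_landauKernelBounds.2
  refine ⟨max C 0, le_max_right _ _, fun H hH p => ?_⟩
  have hlog : 0 ≤ 1 + Real.log H := by
    have : (1 : ℝ) ≤ H := by exact_mod_cast hH
    linarith [Real.log_nonneg this]
  have hG : ∀ e e' : LandauFree H, |(hodgeQ H)⁻¹ e e'| ≤ max C 0 * (1 + Real.log H) := by
    intro e e'
    have h := hC H hH e e'
    have hd : (1 : ℝ) ≤ (1 + ⨆ k : Fin 4, |((e.1.1.1 k - e'.1.1.1 k : ℤ) : ℝ)|) ^ 2 := by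
      have : 0 ≤ ⨆ k : Fin 4, |((e.1.1.1 k - e'.1.1.1 k : ℤ) : ℝ)| := GhostKernel.siteDist_nonneg _ _
      nlinarith
    calc |(hodgeQ H)⁻¹ e e'| ≤ C * (1 + Real.log H) / (1 + ⨆ k : Fin 4, |((e.1.1.1 k - e'.1.1.1 k : ℤ) : ℝ)|) ^ 2 := h
      _ ≤ max C 0 * (1 + Real.log H) / (1 + ⨆ k : Fin 4, |((e.1.1.1 k - e'.1.1.1 k : ℤ) : ℝ)|) ^ 2 :=
          div_le_div_of_nonneg_right (mul_le_mul_of_nonneg_right (le_max_left _ _) hlog) (by positivity)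
      _ ≤ max C 0 * (1 + Real.log H) := div_le_self (mul_nonneg (le_max_right _ _) hlog) hd
  set u := landauCoeff H p with hu
  calc |u ⬝ᵥ ((hodgeQ H)⁻¹ *ᵥ u)| = |∑ e, u e * ∑ e', (hodgeQ H)⁻¹ e e' * u e'| := by rfl
    _ ≤ ∑ e, |u e * ∑ e', (hodgeQ H)⁻¹ e e' * u e'| := Finset.abs_sum_le_sum_abs _ _
    _ ≤ ∑ e, |u e| * ∑ e', max C 0 * (1 + Real.log H) * |u e'| := by
        refine Finset.sum_le_sum fun e _ => ?_
        rw [abs_mul]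
        refine mul_le_mul_of_nonneg_left ((Finset.abs_sum_le_sum_abs _ _).trans (Finset.sum_le_sum fun e' _ => ?_)) (abs_nonneg _)
        rw [abs_mul]
        exact mul_le_mul_of_nonneg_right (hG e e') (abs_nonneg _)
    _ = max C 0 * (1 + Real.log H) * ((∑ e, |u e|) * ∑ e', |u e'|) := by
        rw [Finset.sum_mul_sum, Finset.mul_sum]
        refine Finset.sum_congr rfl fun e _ => ?_
        rw [Finset.mul_sum, Finset.mul_sum]
        exact Finset.sum_congr rfl fun e' _ => by ring
    _ ≤ max C 0 * (1 + Real.log H) * (4 * 4) := by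
        refine mul_le_mul_of_nonneg_left ?_ (mul_nonneg (le_max_right _ _) hlog)
        have h4 := sum_abs_landauCoeff_le H p
        have h0 : 0 ≤ ∑ e : LandauFree H, |u e| := Finset.sum_nonneg fun e _ => abs_nonneg _
        exact mul_le_mul h4 h4 h0 (by norm_num)
    _ = 16 * max C 0 * (1 + Real.log H) := by ring

/-- ★ **Variance of the quadratic plaquette observable**: `E₀[(|ℓ_p|² − E₀|ℓ_p|²)²] ≤ 384·C²·(1 + log H)²/β²` for all `H ≥ 1`, `β > 0`, `p`
(exactly `(3/2)β⁻²K_pp²` by ✓`cov_colourSumSq`, and `K_pp ≤ 16C(1+log H)`). -/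
theorem gaussAvg_centred_linCurvSq_sq_le : ∃ C : ℝ, 0 ≤ C ∧ ∀ H : ℕ, 1 ≤ H → ∀ β : ℝ, 0 < β →
    ∀ p : Literature.MathematicalPhysics.QuantumFieldTheory.Plaq 4,
      gaussAvg β H (fun a => (linCurvSq H p a - gaussAvg β H (linCurvSq H p)) ^ 2) ≤ C * (1 + Real.log H) ^ 2 / β ^ 2 := by
  obtain ⟨C, hC0, hK⟩ := landauCoeff_kernel_diag_le
  refine ⟨384 * C ^ 2, by positivity, fun H hH β hβ p => ?_⟩
  set m := gaussAvg β H (linCurvSq H p) with hm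
  -- integrability of the pieces
  have hc := polyCert_linCurvSq H p
  have hI1 : Integrable (fun a : LandauFree H → E3 => linCurvSq H p a * gaussWeight β H a) := integrable_polyCert_mul_gaussWeight H hβ hc
  have hI2 : Integrable (fun a : LandauFree H → E3 => linCurvSq H p a ^ 2 * gaussWeight β H a) :=
    integrable_polyCert_mul_gaussWeight H hβ (polyCert_pow hc 2)
  have hIm : Integrable (fun a : LandauFree H → E3 => (-(2 * m) * linCurvSq H p a) * gaussWeight β H a) := by
    have := hI1.const_mul (-(2 * m)); refine this.congr (Filter.Eventually.of_forall fun a => by ring)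
  have hI2' : Integrable (fun a : LandauFree H → E3 => linCurvSq H p a * linCurvSq H p a * gaussWeight β H a) :=
    hI2.congr (Filter.Eventually.of_forall fun a => by simp only [pow_two])
  -- `E[(c − m)²] = E[c·c] − m·m`
  have hone : gaussAvg β H (fun _ => m * m) = m * m := by
    unfold gaussAvg
    rw [integral_const_mul, mul_div_assoc, div_self (integral_gaussWeight_pos H hβ).ne', mul_one]
  have hlin : gaussAvg β H (fun a => -(2 * m) * linCurvSq H p a) = -(2 * m) * m := by
    rw [gaussAvg_const_mul]
  have hIc' : Integrable (fun a : LandauFree H → E3 => m * m * gaussWeight β H a) := (integrable_gaussWeight H hβ).const_mul _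
  have hexp : gaussAvg β H (fun a => (linCurvSq H p a - m) ^ 2) =
      gaussAvg β H (fun a => linCurvSq H p a * linCurvSq H p a) - m * m := by
    have hsplit : (fun a : LandauFree H → E3 => (linCurvSq H p a - m) ^ 2) =
        fun a => (linCurvSq H p a * linCurvSq H p a + -(2 * m) * linCurvSq H p a) + m * m := by
      funext a; ring
    rw [hsplit, gaussAvg_add _ _ ?_ hIc', gaussAvg_add _ _ hI2' hIm, hone, hlin]
    · ring
    · have := hI2'.add hIm; refine this.congr (Filter.Eventually.of_forall fun a => by simp only [Pi.add_apply]; ring)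
  -- the covariance identity (definitional unfolding of `gaussAvg`, `linCurvSq`, `gaussWeight`)
  have hvar : gaussAvg β H (fun a => linCurvSq H p a * linCurvSq H p a) - m * m =
      3 / 2 * (β⁻¹) ^ 2 * (landauCoeff H p ⬝ᵥ ((hodgeQ H)⁻¹ *ᵥ landauCoeff H p)) ^ 2 :=
    cov_colourSumSq (hodgeQ H) (hodgeQ_posDef H) hβ (landauCoeff H p) (landauCoeff H p)
  rw [hexp, hvar]
  have hKp := hK H hH p
  have hlog : 0 ≤ 1 + Real.log H := by
    have : (1 : ℝ) ≤ H := by exact_mod_cast hH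
    linarith [Real.log_nonneg this]
  have hsq : (landauCoeff H p ⬝ᵥ ((hodgeQ H)⁻¹ *ᵥ landauCoeff H p)) ^ 2 ≤ (16 * C * (1 + Real.log H)) ^ 2 := by
    rw [← sq_abs]; exact pow_le_pow_left₀ (abs_nonneg _) hKp 2
  have hβ2 : 0 ≤ 3 / 2 * (β⁻¹) ^ 2 := by positivity
  calc 3 / 2 * (β⁻¹) ^ 2 * (landauCoeff H p ⬝ᵥ ((hodgeQ H)⁻¹ *ᵥ landauCoeff H p)) ^ 2
      ≤ 3 / 2 * (β⁻¹) ^ 2 * (16 * C * (1 + Real.log H)) ^ 2 := mul_le_mul_of_nonneg_left hsq hβ2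
    _ = 384 * C ^ 2 * (1 + Real.log H) ^ 2 / β ^ 2 := by rw [inv_pow]; field_simp; ring

end EdgeChartGaussian

end Summit.QuantumFields.YangMills.Theorems.AllWindowsColdBoxBoxHighLine

end
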